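import Literature.MathematicalPhysics.QuantumFieldTheory.Balaban1983to89.B9Ineq3137From149
import Literature.MathematicalPhysics.QuantumFieldTheory.Balaban1983to89.B7LocalityGeneral

/-!
# `Balaban1983to89.B9Ineq3137LocalSup` — T. Bałaban, *Propagators for lattice gauge theories in a background field*, Commun. Math. Phys.
**99** (1985) 389–434 [Balaban1985BackgroundPropagators], (3.137) p. 423 «and the supremum |A| is taken over several j-blocks surrounding
Δ(y)»: **THE LOCAL SUPREMUM IN (3.136)–(3.137) FOR [5]'s CONCRETE `C_j⁽²⁾`** — the (149)-display «|⟨δA,Δ⁽²⁾A⟩| ≦ O(1)C₃Mα₀ΣΣ(Lʲη)^{d−2}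
(Q″_j|δA|)(c)|A|_c» and the hence-step (3.137) with `|A|_c` = the supremum over the bonds of `B^j(c₋) ∪ B^j(c₊)` ONLY, as printed
(p06's `B9Ineq3137From149` carries the GLOBAL supremum `‖a‖` in their place), obtained from the LOCALITY of the averaging operations
([5] p. 24 / p. 31) propagated to the remainder `C_j(U₀,·)` and to its second-order term; FILE 75 of the Sect. B–D programme of cell
`lit-balaban`, seat r06 (B9 fold owner) gen 27

statement-level skeleton of published theorems with citation tags; proofs where landed; nothing here is a claim about the Yang–Mills mass gap

DOCFIX v1.1 (seat r06 gen 28, 2026-08-24; referee ref-4 g84 note D-g84-1, zero weight): the header phrase calling the local-supremum clause of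
`norm_fderiv_secondForm_single_le_local` «VERBATIM» now says what HONEST SCOPE (ii) says — the box of the coarse bond is OUR RENDERING (one reading)
of print's «several j-blocks surrounding Δ(y)». Declarations, statements and proofs are byte-identical to the tree copy of record (p375188,
sha16 8065485b656b1f45).

CITATION HEADER (lean-in-tree rule).  B9 = [Balaban1985BackgroundPropagators] (held `paper:balaban1985-cmp99-background-propagators`, journal
page = PDF page + 388; renders `b2b-balaban-ref1/pages/1985-cmp99-background-propagators/…-p034-x2.png`, `…-p035-x2.png` RE-READ AS IMAGES by
this seat 2026-08-24): p. 422 [PDF 34] «The inequality (149) in [5] implies |⟨δA,Δ⁽²⁾A⟩| ≦ O(1)C₃Mα₀ Σ_{j=0}^{k} Σ_{b∈Λ_j}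
(Lʲη)^{d−2}(Q″_j|δA|)(c)|A|_c,»; p. 423 [PDF 35] «hence |(Δ⁽²⁾A)(b)| ≦ O(1)Mα₀(Lʲη)⁻²|A|, b∈Δ(y), y∈Λ_j, (3.137) and the supremum |A| is
taken over several j-blocks surrounding Δ(y).»  [5] = [Balaban1985Averaging] T. Bałaban, *Averaging operations for lattice gauge theories*,
CMP **98** (1985) 17–51 (journal page = PDF page + 16): p. 24 (after (43)) «this definition is local in the sense that Ū^k_c, c ⊂ Ω^{(k)},
depends only on the bond variables U_b for b ⊂ B^k(c₋) ∪ B^k(c₊). This property will play a very important role in the future», p. 31 (after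
(91)) «have the same locality properties», p. 34 «an analytic function of the variables A_b, b ⊂ B(c₋) ∪ B(c₊)», p. 38 (before (133))
«Q_{j+1}(U₀, ηA) = Q(Ū₀ʲ, Q_j(U₀, ηA))», «Q_{j+1}(U₀) = Q(Ū₀ʲ)Q_j(U₀)», (122) p. 36, (127) p. 37, (136)–(138) p. 39, (141) p. 39 «(Q″_kA)_c =
Σ_{b⊂Bᵏ(c₋)∪Bᵏ(c₊)} η^dA_b», (149) p. 40 «|⟨(δ/δA)C_j(U₀,A), δA⟩| ≦ C₃|A|Q″_j|δA|», (150) p. 40 — as quoted in `B7LocalityGeneral`,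
`B7Eq136SecondOrder`, `B9Ineq3137From149`.  Row **B9.Eq3.134** ((3.134)–(3.137); cells — the head is the lead's word).

WHY THIS FILE.  p06's `B9Ineq3137From149` proves the p. 422 display and the hence-step (3.137) for [5]'s concrete `C_j⁽²⁾` with print's local
norms `|A|_c` («the supremum |A| … over several j-blocks surrounding Δ(y)») READ AS THE GLOBAL SUPREMUM `‖a‖` over all inserted variables
(its (149)-input `B7Eq136SecondOrder.ineq149_secondOrder` is global; locality of `C_j⁽²⁾(U₀,B)(c)` in `B` was listed NOT CLAIMED).  The
locality IS printed ([5] p. 24 / p. 31 / p. 34) and r20's `B7LocalityGeneral.logCovIter_congr` proves it for the composite `Q_j(U₀,·)`.  This file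
propagates it: to the linear parts `LʲηQ_j(U₀)·` (`linCovIter_congr`, the same induction with `B7Prop5GeneralLevels.linQcov_congr`), to the
remainder `C_j = Q_j − LʲηQ_j(U₀)·` (`CCovIter_congr`), to the second-order term (`CCovIter2_ins_boxProj`: `C_j⁽²⁾(U₀, ins_S a)(c) =
C_j⁽²⁾(U₀, ins_S(P_c a))(c)` with `P_c` the coordinate projection onto the bonds of the box), to its derivative (`fderiv_CCovIter2_ins_boxProj`,
chain rule), whence (149) FOR `C_j⁽²⁾` WITH THE LOCAL SUPREMUM (`ineq149_secondOrder_local`: `‖D[C_j⁽²⁾(U₀, ins_S ·)(c)](a)δa‖ ≤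
C₃(Lʲ)²·‖P_c a‖·Σ_s kerQdd(c,s)‖δa_s‖`) and the two [B9] bounds with the printed local norms: **`norm_fderiv_secondForm_le_local`** (the p. 422
display at level `j`: `‖DF(a)δa‖ ≤ C₃(Lʲ)²Σ_{c∈T} w_c‖K(c)‖·‖P_c a‖·Σ_s kerQdd(c,s)‖δa_s‖`, «(Q″_j|δA|)(c)|A|_c» with `|A|_c` LOCAL) and
**`norm_fderiv_secondForm_single_le_local`** ((3.137) at level `j`: for a variation `X·e_s` on ONE fine bond, `‖DF(a)(X·e_s)‖ ≤
2d·κ₀·C₃(Lʲ)²·L^{−jd}·A_loc·‖X‖` for ANY `A_loc` dominating `‖P_c a‖` over the at most `2d` coarse bonds `c ∈ T` whose box contains `s` — «the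
supremum |A| is taken over several j-blocks surrounding Δ(y)»: OUR RENDERING of the printed «several j-blocks surrounding», one reading per HONEST SCOPE (ii)).

DICTIONARY = p06's (`B9Ineq3137From149`: levels rescaled to `ℤᵈ`, `Lʲη ↦ Lʲ`, `η^d ↦ 1`, «b ∈ Λ_j» ↦ `T`, «(Lʲη)^{d+1}» ↦ `w_c ≥ 0`, «(H\*J)(b)» ↦
`K`, «(Q″_j f)(c)» ↦ `Σ_s kerQdd L j c s·f_s`, `|A|·|δA|` ↦ `(Lʲ)²‖a‖‖δa‖`).  NEW: `P_c = boxProj S L j z κ : 𝔸^S →L[ℂ] 𝔸^S` (keep `a_s` for `s`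
in the box `[Lʲz, Lʲz + (Lʲ − 1)𝟙 + Lʲe_κ]` = b07's `loK`/`bondHiK`, zero the rest); `‖P_c a‖` = «|A|_c».

WHAT IS PROVED (kernel, 0 sorry, 0 named facts, standard axioms; two definitions with bodies (`boxInd`, `boxProj`) + theorems).
§1 `linCovIter_congr`, `CCovIter_congr` (locality in the pair (background, field) on the box).  §2 `boxProj` (+ `boxProj_apply`,
`norm_boxProj_apply_le`, `norm_boxProj_le`, `kerQdd_mul_norm_boxProj`, `agreeOn_insCfg_boxProj`), `CCovIter2_ins_boxProj`.  §3 (regime of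
`B7Eq136SecondOrder` VERBATIM) `fderiv_CCovIter2_ins_boxProj`, **`ineq149_secondOrder_local`**.  §4 **`norm_fderiv_secondForm_le_local`**,
**`norm_fderiv_secondForm_single_le_local`**.

HONEST SCOPE / NOT CLAIMED.  (i) As in p06's file: `H`, `J`, `Λ_j` are the letters `K`, `T`, `w`; the `(H\*J)`-bound is the budget `hK`; the
smallness conclusion is not drawn here.  (ii) The local supremum is over the box of the COARSE bond `c` (both blocks `B^j(c₋)`, `B^j(c₊)` and the
bonds between them) — print's «several j-blocks surrounding Δ(y)» for the fine bond is rendered as «any number `A_loc` dominating `‖P_c a‖` for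
the coarse bonds `c ∈ T` seeing the bond» (at most `2d` of them, `B9Ineq3137From149.sum_kerQdd_transpose_le`); one reading, no claim either way.
(iii) Flat `ℤᵈ` carrier per level (p06); no torus.  (iv) The real-coordinate matrix `𝒞` of FILE 74 (`B9Eq3134MatrixConcrete`) is not imported
here (hub olean ordering); the local forms of its §4 bounds follow from this file by the same three lines as there — left to a later touch.
NOT summit progress.

RELATED IN THE TREE, NOT DUPLICATED (searched 2026-08-24: `linCovIter_congr`/`CCovIter_congr`/`CCovIter2.*congr|boxProj` absent from
`Balaban1983to89/`; `logCovIter_congr` EXISTS in r20's `B7LocalityGeneral` and is USED, not restated; one-step `linQcov_congr`/`Ccov_congr`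
exist in `B7Prop5GeneralLevels` and are USED): p06 `B9Ineq3137From149` (global-sup forms, USED: `hasFDerivAt_secondForm`,
`sum_kerQdd_transpose_le`), `B7Eq136SecondOrder` (USED: `hasFDerivAt_CCovIter2_ins`, `ineq149_secondOrder`, `insCfg_smul`), b07
`B7Prop1Local`/`B7Prop5Flat` (boxes, `AgreeOn`, `inBox_nest`, `avgIter_congr`), r06 FILE 74 `B9Eq3134MatrixConcrete` (the matrix `𝒞`; global-sup
bounds).  Unit `lit-balaban-r06`, HOME `run/shared/lean/pub/lit-balaban/`.
-/

noncomputable section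

open scoped BigOperators Topology
open NormedSpace Finset Metric Filter

namespace Literature.MathematicalPhysics.QuantumFieldTheory.Balaban1983to89.B9Ineq3137LocalSup

open B7Prop1Explicit B7Prop1Local B7Prop2Explicit B7Prop3Flat B7Prop4Flat B7Eq92Concrete B7Prop3GeneralLinear
  B7Prop4GeneralLevels B7Prop5GeneralOperators B7Prop5GeneralInduction B7Prop5GeneralLevels B7Ineq149Pairing B7Eq136SecondOrder
  B9Ineq3137From149
open B7Prop5Flat (BondIn inBox_nest)

variable {d : ℕ}

/-! ## §1 LOCALITY of the linear part `LʲηQ_j(U₀)·` and of the remainder `C_j(U₀, ·)` in the box `B^j(c₋) ∪ B^j(c₊)` -/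

section Locality

variable {𝔸 : Type*} [NormedRing 𝔸] [NormedAlgebra ℂ 𝔸] [CompleteSpace 𝔸]

/-- **LOCALITY OF THE LINEAR PARTS «Q_{j+1}(U₀) = Q(Ū₀ʲ)Q_j(U₀)»** (un-normalised composite `linCovIter`): `(LʲηQ_j(U₀)B)(c)`,
`c = ⟨z, z + e_κ⟩` of the `j`-th lattice, depends only on the bond variables of `U₀` AND of `B` in
`B^j(c₋) ∪ B^j(c₊) = [Lʲz, Lʲz + (Lʲ − 1)𝟙 + Lʲe_κ]` — p. 24 «this definition is local in the sense that Ū^k_c … depends only on the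
bond variables U_b for b ⊂ B^k(c₋) ∪ B^k(c₊)», p. 31 «the same locality properties»; the mirror of r20's
`B7LocalityGeneral.logCovIter_congr` for the linear parts (one step = `B7Prop5GeneralLevels.linQcov_congr`).
[cite: Balaban1985Averaging, p.38 (before (133)), (122) p.36, p.24 (after (43)), p.31 (after (91))] -/
theorem linCovIter_congr (L : ℕ) (hL : 1 ≤ L) :
    ∀ (j : ℕ) {U₀ U₀' : B7Prop1Explicit.Site d → Fin d → 𝔸ˣ} {B B' : B7Prop1Explicit.Site d → Fin d → 𝔸}
      (z : B7Prop1Explicit.Site d) (κ : Fin d),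
      AgreeOn (loK L j z) (bondHiK L j z κ) U₀ U₀' → AgreeOn (loK L j z) (bondHiK L j z κ) B B' →
        linCovIter L U₀ B j z κ = linCovIter L U₀' B' j z κ
  | 0, U₀, U₀', B, B', z, κ, _, h => by
    refine h z κ (fun i => ?_) (fun i => ?_)
    · simp only [loK, bondHiK, pow_zero, one_mul]; split_ifs <;> omega
    · simp only [loK, bondHiK, pow_zero, one_mul, add_e_apply]; split_ifs <;> omega
  | j + 1, U₀, U₀', B, B', z, κ, h₀, h => by
    rw [linCovIter_succ, linCovIter_succ]
    refine linQcov_congr L hL _ κ (fun x μ hx hxe => ?_) (fun x μ hx hxe => ?_)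
    · exact avgIter_congr L hL j x μ fun p ν hp hpν =>
        h₀ p ν (inBox_nest L j z κ ⟨hx, hxe⟩ hp) (inBox_nest L j z κ ⟨hx, hxe⟩ hpν)
    · exact linCovIter_congr L hL j x μ
        (fun p ν hp hpν => h₀ p ν (inBox_nest L j z κ ⟨hx, hxe⟩ hp) (inBox_nest L j z κ ⟨hx, hxe⟩ hpν))
        (fun p ν hp hpν => h p ν (inBox_nest L j z κ ⟨hx, hxe⟩ hp) (inBox_nest L j z κ ⟨hx, hxe⟩ hpν))

/-- **LOCALITY OF THE REMAINDER `C_j(U₀, B)(c)` (150)** = `Q_j(U₀, B)(c) − LʲηQ_j(U₀)B(c)`: it depends only on `U₀` and `B` on the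
bonds of `B^j(c₋) ∪ B^j(c₊)` (`B7LocalityGeneral.logCovIter_congr` − `linCovIter_congr`).
[cite: Balaban1985Averaging, (150) p.40, (127) p.37, p.24 (after (43)), p.31 (after (91))] -/
theorem CCovIter_congr (L : ℕ) (hL : 1 ≤ L) (j : ℕ) {U₀ U₀' : B7Prop1Explicit.Site d → Fin d → 𝔸ˣ}
    {B B' : B7Prop1Explicit.Site d → Fin d → 𝔸} (z : B7Prop1Explicit.Site d) (κ : Fin d)
    (h₀ : AgreeOn (loK L j z) (bondHiK L j z κ) U₀ U₀') (h : AgreeOn (loK L j z) (bondHiK L j z κ) B B') :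
    CCovIter L U₀ B j z κ = CCovIter L U₀' B' j z κ := by
  rw [CCovIter, CCovIter, B7LocalityGeneral.logCovIter_congr L hL j z κ h₀ h, linCovIter_congr L hL j z κ h₀ h]

/-! ## §2 The chart projection `P_c` on `𝔸^S`: keep the coordinates on the bonds of `B^j(c₋) ∪ B^j(c₊)`, zero the others -/

/-- the indicator of «`s ⊂ B^j(c₋) ∪ B^j(c₊)`» as a complex scalar. [cite: Balaban1985Averaging, (141) p.39, p.24 (after (43))] -/
def boxInd (L j : ℕ) (z : B7Prop1Explicit.Site d) (κ : Fin d) (s : B7Prop1Explicit.Site d × Fin d) : ℂ := by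
  classical
  exact if BondIn (loK L j z) (bondHiK L j z κ) s.1 s.2 then 1 else 0

/-- **THE CHART PROJECTION `P_c`** on the finitely many variables `a ∈ 𝔸^S`: `(P_c a)_s = a_s` if the fine bond `s` lies in the box
`B^j(c₋) ∪ B^j(c₊)` of the coarse bond `c = (z, κ)`, `0` otherwise — a continuous `ℂ`-linear map («the variables A_b,
b ⊂ B(c₋) ∪ B(c₊)», p. 34; `‖P_c a‖` = print's LOCAL supremum `|A|_c`). [cite: Balaban1985Averaging, p.34, (141) p.39]
[cite: Balaban1985BackgroundPropagators, (3.137) p.423] -/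
def boxProj (S : Finset (B7Prop1Explicit.Site d × Fin d)) (L j : ℕ) (z : B7Prop1Explicit.Site d) (κ : Fin d) :
    (S → 𝔸) →L[ℂ] (S → 𝔸) :=
  ContinuousLinearMap.pi fun s : S => boxInd L j z κ s.1 • ContinuousLinearMap.proj (R := ℂ) (φ := fun _ : S => 𝔸) s

open Classical in
omit [CompleteSpace 𝔸] in
/-- `(P_c a)_s` evaluated. [cite: Balaban1985BackgroundPropagators, (3.137) p.423] -/
theorem boxProj_apply (S : Finset (B7Prop1Explicit.Site d × Fin d)) (L j : ℕ) (z : B7Prop1Explicit.Site d) (κ : Fin d)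
    (a : S → 𝔸) (s : S) :
    boxProj S L j z κ a s = if BondIn (loK L j z) (bondHiK L j z κ) s.1.1 s.1.2 then a s else 0 := by
  classical
  simp only [boxProj, ContinuousLinearMap.pi_apply, _root_.smul_apply, ContinuousLinearMap.proj_apply, boxInd]
  split_ifs <;> simp

omit [CompleteSpace 𝔸] in
/-- `‖(P_c a)_s‖ ≤ ‖a_s‖`. [cite: Balaban1985BackgroundPropagators, (3.137) p.423] -/
theorem norm_boxProj_apply_le (S : Finset (B7Prop1Explicit.Site d × Fin d)) (L j : ℕ) (z : B7Prop1Explicit.Site d)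
    (κ : Fin d) (a : S → 𝔸) (s : S) : ‖boxProj S L j z κ a s‖ ≤ ‖a s‖ := by
  rw [boxProj_apply]
  split_ifs
  · exact le_rfl
  · rw [norm_zero]; exact norm_nonneg _

omit [CompleteSpace 𝔸] in
/-- `‖P_c a‖ ≤ ‖a‖` (the local supremum is at most the global one). [cite: Balaban1985BackgroundPropagators, (3.137) p.423] -/
theorem norm_boxProj_le (S : Finset (B7Prop1Explicit.Site d × Fin d)) (L j : ℕ) (z : B7Prop1Explicit.Site d) (κ : Fin d)
    (a : S → 𝔸) : ‖boxProj S L j z κ a‖ ≤ ‖a‖ :=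
  (pi_norm_le_iff_of_nonneg (norm_nonneg _)).2 fun s => (norm_boxProj_apply_le S L j z κ a s).trans (norm_le_pi_norm a s)

omit [CompleteSpace 𝔸] in
/-- the kernel `kerQdd(c, s)` of (141) vanishes off the box, so `kerQdd(c,s)·‖(P_c δa)_s‖ = kerQdd(c,s)·‖δa_s‖`.
[cite: Balaban1985Averaging, (141) p.39] -/
theorem kerQdd_mul_norm_boxProj (S : Finset (B7Prop1Explicit.Site d × Fin d)) (L j : ℕ) (z : B7Prop1Explicit.Site d)
    (κ : Fin d) (δa : S → 𝔸) (s : S) :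
    kerQdd L j z κ s.1.1 s.1.2 * ‖boxProj S L j z κ δa s‖ = kerQdd L j z κ s.1.1 s.1.2 * ‖δa s‖ := by
  rw [boxProj_apply]
  by_cases h : BondIn (loK L j z) (bondHiK L j z κ) s.1.1 s.1.2
  · rw [if_pos h]
  · rw [if_neg h, kerQdd_of_not_bondIn h, zero_mul, zero_mul]

omit [CompleteSpace 𝔸] in
/-- the inserted fields `ins_S a` and `ins_S(P_c a)` AGREE on the bonds of the box `B^j(c₋) ∪ B^j(c₊)`.
[cite: Balaban1985Averaging, p.34, p.24 (after (43))] -/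
theorem agreeOn_insCfg_boxProj (S : Finset (B7Prop1Explicit.Site d × Fin d)) (L j : ℕ) (z : B7Prop1Explicit.Site d)
    (κ : Fin d) (a : S → 𝔸) :
    AgreeOn (loK L j z) (bondHiK L j z κ) (insCfg S a) (insCfg S (boxProj S L j z κ a)) := by
  intro x μ hx hxe
  by_cases hS : (x, μ) ∈ S
  · simp only [insCfg, hS, dite_true]
    rw [boxProj_apply, if_pos (show BondIn (loK L j z) (bondHiK L j z κ) x μ from ⟨hx, hxe⟩)]
  · simp only [insCfg, hS, dite_false]

/-- **`C_j⁽²⁾(U₀, ins_S a)(c)` DEPENDS ON `a` ONLY THROUGH `P_c a`**: the second-order term of (136) at the coarse bond `c` is a function of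
the variables on `B^j(c₋) ∪ B^j(c₊)` («a second order term in the expansion of Q_j(ηA)», [B9] p. 421, and the locality of
`Q_j`, [B7] p. 24 / p. 31). [cite: Balaban1985Averaging, (136) p.39, p.24 (after (43))] [cite: Balaban1985BackgroundPropagators, (3.127) p.421] -/
theorem CCovIter2_ins_boxProj (L : ℕ) (hL : 1 ≤ L) (U₀ : B7Prop1Explicit.Site d → Fin d → 𝔸ˣ)
    (S : Finset (B7Prop1Explicit.Site d × Fin d)) (j : ℕ) (z : B7Prop1Explicit.Site d) (κ : Fin d) (a : S → 𝔸) :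
    CCovIter2 L U₀ (insCfg S a) j z κ = CCovIter2 L U₀ (insCfg S (boxProj S L j z κ a)) j z κ := by
  rw [CCovIter2, CCovIter2]
  congr 1
  have hslice : (fun t : ℂ => CCovIter L U₀ (t • insCfg S a) j z κ) =
      fun t : ℂ => CCovIter L U₀ (t • insCfg S (boxProj S L j z κ a)) j z κ := by
    funext t
    rw [← insCfg_smul, ← insCfg_smul, ← map_smul]
    exact CCovIter_congr L hL j z κ (fun _ _ _ _ => rfl) (agreeOn_insCfg_boxProj S L j z κ (t • a))
  rw [hslice]

end Locality

/-! ## §3 The derivative factorises through `P_c`; (149) FOR `C_j⁽²⁾` WITH THE LOCAL SUPREMUM `|A|_c` -/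

section Concrete

variable {𝔸 : Type*} [NormedRing 𝔸] [NormedAlgebra ℂ 𝔸] [CompleteSpace 𝔸] [NormOneClass 𝔸]

variable (L : ℕ) (hL : 2 ≤ L) {G : Subgroup 𝔸ˣ} (hG : AvgClosed d L G) (k : ℕ)
  (U₀ : B7Prop1Explicit.Site d → Fin d → 𝔸ˣ) (hU₀ : ∀ x κ, U₀ x κ ∈ G) {α₀ : ℝ} (hα : 0 < α₀)
  (hα3 : C0 d * α₀ ≤ 1 / 3) (hα4 : 4 * α₀ ≤ c2' d L) (h52 : pdev U₀ < α₀ * (((L : ℝ) ^ k)⁻¹) ^ 2)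
  {b : ℝ} (hb : 0 < b)
  (hsmall : Real.exp (4 * (800 * ((d : ℝ) + 1) ^ 2 * ((d : ℝ) + 4)) * α₀)
    * (1 + 8 * (131072 * ((d : ℝ) + 1) ^ 2) * ((L : ℝ) ^ k * b)) ≤ 2)
  (hc₃ : 4 * ((L : ℝ) ^ k * b) < c3 d L)
  (h145 : 8 * d * thetaGen d L α₀ * (L : ℝ)⁻¹ ^ 4 ≤ 1)
  (h155 : (2 * (L : ℝ) - 1) * (L : ℝ)⁻¹ ^ 2 + 2 * d * thetaGen d L α₀ * (L : ℝ)⁻¹ ^ 3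
    + 1 / 8 * (1 + 2 * d * thetaGen d L α₀ * (L : ℝ)⁻¹ ^ 2 + 2 * d * C3Gen d L * ((L : ℝ) ^ k * b)) * (L : ℝ)⁻¹ ^ 2 ≤ 1)
  (S : Finset (B7Prop1Explicit.Site d × Fin d))

include hL hG hU₀ hα hα3 hα4 h52 hb hsmall hc₃ in
/-- **`D[C_j⁽²⁾(U₀, ins_S ·)(c)](a)δa = D[C_j⁽²⁾(U₀, ins_S ·)(c)](P_c a)(P_c δa)`** — the functional derivative (137)–(138) of the second-order
term sees `a` and `δa` only on the bonds of `B^j(c₋) ∪ B^j(c₊)` (chain rule through the projection `P_c`).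
[cite: Balaban1985Averaging, (136)–(138) p.39, p.24 (after (43))] [cite: Balaban1985BackgroundPropagators, (3.136) p.422] -/
theorem fderiv_CCovIter2_ins_boxProj {j : ℕ} (hj : j ≤ k) (z : B7Prop1Explicit.Site d) (κ : Fin d) (a δa : S → 𝔸) :
    fderiv ℂ (fun a' : S → 𝔸 => CCovIter2 L U₀ (insCfg S a') j z κ) a δa =
      fderiv ℂ (fun a' : S → 𝔸 => CCovIter2 L U₀ (insCfg S a') j z κ) (boxProj S L j z κ a) (boxProj S L j z κ δa) := by
  have hL1 : 1 ≤ L := le_trans (by norm_num) hL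
  have hfun : (fun a' : S → 𝔸 => CCovIter2 L U₀ (insCfg S a') j z κ) =
      (fun a' : S → 𝔸 => CCovIter2 L U₀ (insCfg S a') j z κ) ∘ (boxProj S L j z κ) := by
    funext a'
    exact CCovIter2_ins_boxProj L hL1 U₀ S j z κ a'
  have hP : HasFDerivAt (⇑(boxProj (𝔸 := 𝔸) S L j z κ)) (boxProj S L j z κ) a :=
    (boxProj (𝔸 := 𝔸) S L j z κ).hasFDerivAt
  have hf : HasFDerivAt (fun a' : S → 𝔸 => CCovIter2 L U₀ (insCfg S a') j z κ)
      (fderiv ℂ (fun a' : S → 𝔸 => CCovIter2 L U₀ (insCfg S a') j z κ) (boxProj S L j z κ a)) (boxProj S L j z κ a) :=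
    (hasFDerivAt_CCovIter2_ins L hL hG k U₀ hU₀ hα hα3 hα4 h52 hb hsmall hc₃ S hj z κ
      (boxProj S L j z κ a)).differentiableAt.hasFDerivAt
  have hcomp : HasFDerivAt ((fun a' : S → 𝔸 => CCovIter2 L U₀ (insCfg S a') j z κ) ∘ (boxProj S L j z κ))
      ((fderiv ℂ (fun a' : S → 𝔸 => CCovIter2 L U₀ (insCfg S a') j z κ) (boxProj S L j z κ a)).comp
        (boxProj S L j z κ)) a := hf.comp a hP
  rw [← hfun] at hcomp
  rw [hcomp.fderiv, ContinuousLinearMap.comp_apply]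

include hL hG hU₀ hα hα3 hα4 h52 hb hsmall hc₃ h145 h155 in
/-- **(149) FOR `C_j⁽²⁾` WITH THE LOCAL SUPREMUM**: `‖D[C_j⁽²⁾(U₀, ins_S ·)(c)](a)δa‖ ≤ C₃(Lʲ)²·‖P_c a‖·Σ_s kerQdd(c,s)‖δa_s‖` — print's
«C₃|A|Q″_j|δA|» with `|A| = |A|_c` the supremum over the bonds of `B^j(c₋) ∪ B^j(c₊)` only (p06's `B7Eq136SecondOrder.ineq149_secondOrder`
carries the global `‖a‖`; the locality of §1 localises it). [cite: Balaban1985Averaging, (149) p.40, (141) p.39, p.24 (after (43))]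
[cite: Balaban1985BackgroundPropagators, (3.136) p.422] -/
theorem ineq149_secondOrder_local {j : ℕ} (hj : j ≤ k) (z : B7Prop1Explicit.Site d) (κ : Fin d) (a δa : S → 𝔸) :
    ‖fderiv ℂ (fun a' : S → 𝔸 => CCovIter2 L U₀ (insCfg S a') j z κ) a δa‖ ≤
      C3Gen d L * ((L : ℝ) ^ j) ^ 2 * ‖boxProj S L j z κ a‖ * ∑ s : S, kerQdd L j z κ s.1.1 s.1.2 * ‖δa s‖ := by
  rw [fderiv_CCovIter2_ins_boxProj L hL hG k U₀ hU₀ hα hα3 hα4 h52 hb hsmall hc₃ S hj z κ a δa]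
  obtain ⟨-, hbd⟩ := ineq149_secondOrder L hL hG k U₀ hU₀ hα hα3 hα4 h52 hb hsmall hc₃ h145 h155 S hj z κ
    (boxProj S L j z κ a) (boxProj S L j z κ δa)
  refine hbd.trans (le_of_eq ?_)
  congr 1
  exact Finset.sum_congr rfl fun s _ => kerQdd_mul_norm_boxProj S L j z κ δa s

/-! ## §4 (3.136)/(3.137) at level `j` with the LOCAL suprema «|A|_c» and «the supremum |A| … over several j-blocks surrounding Δ(y)» -/

variable (T : Finset (B7Prop1Explicit.Site d × Fin d)) (w : B7Prop1Explicit.Site d × Fin d → ℝ)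
  (K : B7Prop1Explicit.Site d × Fin d → 𝔸)

include hL hG hU₀ hα hα3 hα4 h52 hb hsmall hc₃ h145 h155 in
/-- **THE DISPLAY AT LEVEL `j` WITH THE LOCAL `|A|_c`**: for `w_c ≥ 0`,
`‖DF(a)δa‖ ≤ C₃(Lʲ)²·Σ_{c∈T} w_c‖K(c)‖·‖P_c a‖·Σ_s kerQdd(c,s)‖δa_s‖` — «O(1)C₃Mα₀ Σ_{b∈Λ_j}(Lʲη)^{d−2}(Q″_j|δA|)(b)|A|_b» with `|A|_b` the
supremum over `B^j(b₋) ∪ B^j(b₊)` AS PRINTED (p06's `norm_fderiv_secondForm_le` has the global sup).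
[cite: Balaban1985BackgroundPropagators, (3.136) p.422, (3.137) p.423] [cite: Balaban1985Averaging, (149) p.40] -/
theorem norm_fderiv_secondForm_le_local (hw : ∀ c ∈ T, 0 ≤ w c) {j : ℕ} (hj : j ≤ k) (a δa : S → 𝔸) :
    ‖fderiv ℂ (fun a' : S → 𝔸 => ∑ c ∈ T, (w c : ℂ) • (CCovIter2 L U₀ (insCfg S a') j c.1 c.2 * K c)) a δa‖ ≤
      C3Gen d L * ((L : ℝ) ^ j) ^ 2 *
        ∑ c ∈ T, w c * ‖K c‖ * ‖boxProj S L j c.1 c.2 a‖ * ∑ s : S, kerQdd L j c.1 c.2 s.1.1 s.1.2 * ‖δa s‖ := by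
  rw [(hasFDerivAt_secondForm L hL hG k U₀ hU₀ hα hα3 hα4 h52 hb hsmall hc₃ S T w K hj a).fderiv, Finset.mul_sum,
    _root_.sum_apply]
  refine norm_sum_le_of_le _ fun c hc => ?_
  rw [_root_.smul_apply, ContinuousLinearMap.smulRight_apply, norm_smul, Complex.norm_real, Real.norm_of_nonneg (hw c hc)]
  have hbd := ineq149_secondOrder_local L hL hG k U₀ hU₀ hα hα3 hα4 h52 hb hsmall hc₃ h145 h155 S hj c.1 c.2 a δa
  have hQ0 : 0 ≤ ∑ s : S, kerQdd L j c.1 c.2 s.1.1 s.1.2 * ‖δa s‖ :=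
    Finset.sum_nonneg fun s _ => mul_nonneg (kerQdd_nonneg L j _ _ _ _) (norm_nonneg _)
  calc w c * ‖fderiv ℂ (fun a' : S → 𝔸 => CCovIter2 L U₀ (insCfg S a') j c.1 c.2) a δa • K c‖
      ≤ w c * (‖fderiv ℂ (fun a' : S → 𝔸 => CCovIter2 L U₀ (insCfg S a') j c.1 c.2) a δa‖ * ‖K c‖) :=
        mul_le_mul_of_nonneg_left (norm_smul_le _ _) (hw c hc)
    _ ≤ w c * ((C3Gen d L * ((L : ℝ) ^ j) ^ 2 * ‖boxProj S L j c.1 c.2 a‖ *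
          ∑ s : S, kerQdd L j c.1 c.2 s.1.1 s.1.2 * ‖δa s‖) * ‖K c‖) :=
        mul_le_mul_of_nonneg_left (mul_le_mul_of_nonneg_right hbd (norm_nonneg _)) (hw c hc)
    _ = C3Gen d L * ((L : ℝ) ^ j) ^ 2 * (w c * ‖K c‖ * ‖boxProj S L j c.1 c.2 a‖ *
          ∑ s : S, kerQdd L j c.1 c.2 s.1.1 s.1.2 * ‖δa s‖) := by ring

include hL hG hU₀ hα hα3 hα4 h52 hb hsmall hc₃ h145 h155 in
/-- **(3.137) AT LEVEL `j` WITH «the supremum |A| … taken over several j-blocks surrounding Δ(y)»**: if `w_c‖K(c)‖ ≤ κ₀` on `T`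
(«(Lʲη)^{d+1}·O(1)Mα₀(Lʲη)⁻³») and `A_loc` dominates the local suprema `‖P_c a‖` for the (at most `2d`) coarse bonds `c ∈ T` whose box
contains the fine bond `s` — exactly the printed «several j-blocks surrounding» —, then for a variation `X·e_s` on that ONE fine bond
`‖DF(a)(X·e_s)‖ ≤ 2d·κ₀·C₃(Lʲ)²·L^{−jd}·A_loc·‖X‖` (p06's `norm_fderiv_secondForm_single_le` has the global `‖a‖` in place of `A_loc`).
[cite: Balaban1985BackgroundPropagators, (3.137) p.423] [cite: Balaban1985Averaging, (141)–(142) p.39, (149) p.40] -/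
theorem norm_fderiv_secondForm_single_le_local (hw : ∀ c ∈ T, 0 ≤ w c) {κ₀ : ℝ} (hκ₀ : 0 ≤ κ₀)
    (hK : ∀ c ∈ T, w c * ‖K c‖ ≤ κ₀) {j : ℕ} (hj : j ≤ k) (a : S → 𝔸) (s : S) (X : 𝔸) {Aloc : ℝ} (hAloc0 : 0 ≤ Aloc)
    (hAloc : ∀ c ∈ T, BondIn (loK L j c.1) (bondHiK L j c.1 c.2) s.1.1 s.1.2 → ‖boxProj S L j c.1 c.2 a‖ ≤ Aloc) :
    ‖fderiv ℂ (fun a' : S → 𝔸 => ∑ c ∈ T, (w c : ℂ) • (CCovIter2 L U₀ (insCfg S a') j c.1 c.2 * K c)) a (Pi.single s X)‖ ≤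
      2 * d * κ₀ * (C3Gen d L * ((L : ℝ) ^ j) ^ 2 * (((L : ℝ) ^ j) ^ d)⁻¹) * Aloc * ‖X‖ := by
  classical
  have hL1 : 1 ≤ L := le_trans (by norm_num) hL
  have hC : 0 ≤ C3Gen d L := by unfold C3Gen C1ppGen; positivity
  have h := norm_fderiv_secondForm_le_local L hL hG k U₀ hU₀ hα hα3 hα4 h52 hb hsmall hc₃ h145 h155 S T w K hw hj a
    (Pi.single s X)
  -- the inner sum over `S` sees only the bond `s`
  have hinner : ∀ c ∈ T, ∑ s' : S, kerQdd L j c.1 c.2 s'.1.1 s'.1.2 * ‖(Pi.single s X : S → 𝔸) s'‖ =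
      kerQdd L j c.1 c.2 s.1.1 s.1.2 * ‖X‖ := by
    intro c _
    rw [Finset.sum_eq_single s]
    · simp
    · intro s' _ hs'
      simp [Pi.single_eq_of_ne hs']
    · intro hs; exact absurd (Finset.mem_univ s) hs
  rw [Finset.sum_congr rfl fun c hc => by rw [hinner c hc]] at h
  refine h.trans ?_
  -- termwise: `w‖K‖ ≤ κ₀`, and `‖P_c a‖·kerQdd(c,s) ≤ A_loc·kerQdd(c,s)` (kerQdd(c,s) = 0 unless `s` lies in the box of `c`)
  have hstep : ∑ c ∈ T, w c * ‖K c‖ * ‖boxProj S L j c.1 c.2 a‖ * (kerQdd L j c.1 c.2 s.1.1 s.1.2 * ‖X‖) ≤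
      κ₀ * Aloc * ((2 * d * (((L : ℝ) ^ j) ^ d)⁻¹) * ‖X‖) := by
    calc ∑ c ∈ T, w c * ‖K c‖ * ‖boxProj S L j c.1 c.2 a‖ * (kerQdd L j c.1 c.2 s.1.1 s.1.2 * ‖X‖)
        ≤ ∑ c ∈ T, κ₀ * Aloc * (kerQdd L j c.1 c.2 s.1.1 s.1.2 * ‖X‖) := by
          refine Finset.sum_le_sum fun c hc => ?_
          by_cases hb : BondIn (loK L j c.1) (bondHiK L j c.1 c.2) s.1.1 s.1.2
          · exact mul_le_mul_of_nonneg_right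
              (mul_le_mul (hK c hc) (hAloc c hc hb) (norm_nonneg _) hκ₀)
              (mul_nonneg (kerQdd_nonneg L j _ _ _ _) (norm_nonneg _))
          · rw [kerQdd_of_not_bondIn hb, zero_mul, mul_zero, mul_zero]
      _ = κ₀ * Aloc * ((∑ c ∈ T, kerQdd L j c.1 c.2 s.1.1 s.1.2) * ‖X‖) := by rw [← Finset.mul_sum, Finset.sum_mul]
      _ ≤ κ₀ * Aloc * ((2 * d * (((L : ℝ) ^ j) ^ d)⁻¹) * ‖X‖) :=
          mul_le_mul_of_nonneg_left
            (mul_le_mul_of_nonneg_right (sum_kerQdd_transpose_le hL1 j T s.1.1 s.1.2) (norm_nonneg _))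
            (mul_nonneg hκ₀ hAloc0)
  have hK0 : 0 ≤ C3Gen d L * ((L : ℝ) ^ j) ^ 2 := by positivity
  calc C3Gen d L * ((L : ℝ) ^ j) ^ 2 *
        ∑ c ∈ T, w c * ‖K c‖ * ‖boxProj S L j c.1 c.2 a‖ * (kerQdd L j c.1 c.2 s.1.1 s.1.2 * ‖X‖)
      ≤ C3Gen d L * ((L : ℝ) ^ j) ^ 2 * (κ₀ * Aloc * ((2 * d * (((L : ℝ) ^ j) ^ d)⁻¹) * ‖X‖)) :=
        mul_le_mul_of_nonneg_left hstep hK0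
    _ = 2 * d * κ₀ * (C3Gen d L * ((L : ℝ) ^ j) ^ 2 * (((L : ℝ) ^ j) ^ d)⁻¹) * Aloc * ‖X‖ := by ring

end Concrete

end Literature.MathematicalPhysics.QuantumFieldTheory.Balaban1983to89.B9Ineq3137LocalSup

end
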